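import Summits.QuantumFields.YangMills.Theorems.LuscherReductionTwistedTraceScalingValleyLinkProx
import HarnessLib

/-!
# The C3 skeleton with an `o(δ)` tolerance: `ValleyBOWeakAt` — the Born–Oppenheimer sub-target in the currency the composition actually needs
# (lane A of S-BASE, crux `TwistedTraceScaling` stmt-QuantumFields-20203; design note `pub/ym-fleet/ym-luscher-20007-p1/COARSE-DESIGN.md` §16–§17)

`ValleyBOAt L δ η` (`…ValleySkeleton`) asks for the pointwise super-solution bound with a `U`-independent slack `e^{ε·λ_b(L³β)}` and a floor
`N·e^{−6Z₀}·e^{−C·λ_b} ≤ λ₀` with the SAME `N` — i.e. a `U`-independent error budget of `O(λ_b) = O(β^{−1/3})`.  The composition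
(`valleyKernelRowBoundAt_of_bo_geom`) only ever spends the VALLEY GAIN `2·gain1Slope·c₀·δ(β)`, and `λ_b = o(δ)`; so the honest currency of the slack is
`o(δ(β))`, not `O(λ_b)`.  This matters: with the far-chart radius `ρ² ≍ β^{−(q−p)}` the curvature–step cross term of the exact action increment
(`…StepActionExact`, `1728·N_P·τ²√σ`) costs `β·ρ²·√(2η) ≍ β^{1−3q/2+p}` (`= β^{−0.2125}` at `(p,q) = (1/16, 0.85)`), which is NOT `O(β^{−1/3})` for any
`q < 8/9` but IS `o(β^{−p})` whenever `q > 2/3 + 4p/3`.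
* `ValleyBOWeakAt L δ η` — `∃ κ > 0, ∀ ε > 0`, eventually `∃ N > 0`: `N·e^{−6·toronZPE L κ 0 0}·e^{−ε·δ(β)} ≤ λ₀(β,L)` AND a measurable weight `h`
  (`0 ≤ h ≤ C_h`, `h ≥ c > 0` on the valley) with `(K_β h)(U) ≤ N·e^{ε·δ(β)}·e^{−zpeSum L κ U}·h(U)` on `valleySet L (δ β) (η β)`;
* `valleyBOWeakAt_of_valleyBOAt` — it IS a weakening (given `λ_b = o(δ)`);
* ★★★ `valleyKernelRowBoundAt_of_boWeak_geom` — the C3 composition with the weak BO sub-target (tolerances tuned to a quarter of the gain each);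
* ★★★ `coarseNoIntruderAt_of_boWeak_pow` — END TO END: `0 < p < 1/3 → 4p < q < 8/9 → ValleyBOWeakAt L (β^{−p}) (β^{−q}) → InnerNoIntruderOneOrbitAt L (β^{−p}) →
  COARSE-UPPER(L)` (geometry discharged by `valleyGeomAt_pow`, `…ValleyLinkProx`).
HONEST FRAMING: a kernel-checked reduction; `ValleyBOWeakAt` is OPEN (lane B's chain at `σ = 2β^{−q}` + C3d); femto rung R2b1 of the CONDITIONAL reduction route;
not infinite volume, not a gap, not Clay.
-/

set_option autoImplicit false

noncomputable section

open MeasureTheory Filter Topology Real Module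
open scoped BigOperators InnerProductSpace
open Literature.MathematicalPhysics.QuantumFieldTheory
open Literature.MathematicalPhysics.QuantumLattice

namespace Summit.QuantumFields.YangMills.Theorems.FemtoTransferGap

open TwoLattice TwoLattice.Toron TwoLattice.Cov TwoLattice.Stiff

variable (L : ℕ) [NeZero L]

/-! ## §1 The weak BO sub-target -/

/-- **Sub-target BO, weak (honest) currency** (OPEN): `∃ κ > 0, ∀ ε > 0`, eventually in `β`, `∃ N > 0` with the FLOOR `N·e^{−6·toronZPE L κ 0 0}·e^{−ε·δ(β)} ≤ λ₀(β,L)`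
and a measurable weight `h`, `0 ≤ h ≤ C_h`, `h ≥ c > 0` on the valley set, with `(K_β h)(U) ≤ N·e^{ε·δ(β)}·e^{−zpeSum L κ U}·h(U)` at every valley point: the
`U`-independent error budget is `o(δ(β))` on both sides.  Target text of this programme (Lüscher 1983 §3, Wipf 2021 §8.5), not a published theorem. -/
def ValleyBOWeakAt (δ η : ℝ → ℝ) : Prop :=
  ∃ κ : ℝ, 0 < κ ∧ ∀ ε : ℝ, 0 < ε → ∃ β0 : ℝ, ∀ β : ℝ, β0 ≤ β →
    ∃ N : ℝ, 0 < N ∧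
      N * Real.exp (-(6 * toronZPE L κ 0 0)) * Real.exp (-(ε * δ β)) ≤ levelValue su2Rep L β 0 ∧
      ∃ (h : GaugeConfig 3 L SU2 → ℝ) (c Ch : ℝ), Measurable h ∧ 0 < c ∧ (∀ U, 0 ≤ h U) ∧ (∀ U, h U ≤ Ch) ∧
        (∀ U ∈ valleySet L (δ β) (η β), c ≤ h U) ∧
        ∀ U ∈ valleySet L (δ β) (η β),
          transferApply β h U ≤ N * Real.exp (ε * δ β) * Real.exp (-zpeSum L κ U) * h U

variable {L}

/-- `ValleyBOAt → ValleyBOWeakAt` whenever `λ_b(L³β) = o(δ(β))` (`∀ M`, eventually `M·λ_b ≤ δ`): the weak form IS weaker. [cite: Luscher1983, §3] -/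
theorem valleyBOWeakAt_of_valleyBOAt {δ η : ℝ → ℝ} (hBO : ValleyBOAt L δ η) (hδ0 : ∀ β, 0 < δ β)
    (hδ : ∀ M : ℝ, ∃ β0 : ℝ, ∀ β : ℝ, β0 ≤ β → M * bareLambda ((L : ℝ) ^ 3 * β) ≤ δ β) : ValleyBOWeakAt L δ η := by
  obtain ⟨κ, hκ, C, hC, hbo⟩ := hBO
  refine ⟨κ, hκ, fun ε hε => ?_⟩
  obtain ⟨βB, hB⟩ := hbo 1 one_pos
  obtain ⟨βM, hM⟩ := hδ ((C + 1) / ε)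
  refine ⟨max βB βM, fun β hβ => ?_⟩
  have hβB : βB ≤ β := (le_max_left _ _).trans hβ
  have hβM : βM ≤ β := (le_max_right _ _).trans hβ
  obtain ⟨N, hN, hfloor, h, c, Ch, hhm, hc, hh0, hhC, hhc, hrow⟩ := hB β hβB
  set lam : ℝ := bareLambda ((L : ℝ) ^ 3 * β) with hlam
  have hscale : (C + 1) * lam ≤ ε * δ β := by
    have h1 := hM β hβM
    rw [div_mul_eq_mul_div, div_le_iff₀ hε] at h1
    linarith
  have hεδ0 : 0 ≤ ε * δ β := mul_nonneg hε.le (hδ0 β).le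
  have hClam : C * lam ≤ ε * δ β := by
    rcases le_or_gt 0 lam with hl | hl
    · nlinarith
    · nlinarith
  have h1lam : 1 * lam ≤ ε * δ β := by
    rcases le_or_gt 0 lam with hl | hl
    · nlinarith
    · nlinarith
  refine ⟨N, hN, ?_, h, c, Ch, hhm, hc, hh0, hhC, hhc, fun U hU => ?_⟩
  · -- floor: `e^{−εδ} ≤ e^{−C lam}`
    calc N * Real.exp (-(6 * toronZPE L κ 0 0)) * Real.exp (-(ε * δ β))
        ≤ N * Real.exp (-(6 * toronZPE L κ 0 0)) * Real.exp (-(C * lam)) := by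
          refine mul_le_mul_of_nonneg_left (Real.exp_le_exp.2 ?_) (by positivity)
          linarith
      _ ≤ levelValue su2Rep L β 0 := hfloor
  · -- upper: `e^{1·lam} ≤ e^{εδ}`
    refine (hrow U hU).trans ?_
    have hzz : 0 ≤ Real.exp (-zpeSum L κ U) * h U := mul_nonneg (Real.exp_pos _).le (hh0 U)
    have : N * Real.exp (1 * lam) ≤ N * Real.exp (ε * δ β) := by
      exact mul_le_mul_of_nonneg_left (Real.exp_le_exp.2 h1lam) hN.le
    calc N * Real.exp (1 * lam) * Real.exp (-zpeSum L κ U) * h U = (N * Real.exp (1 * lam)) * (Real.exp (-zpeSum L κ U) * h U) := by ring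
      _ ≤ (N * Real.exp (ε * δ β)) * (Real.exp (-zpeSum L κ U) * h U) := mul_le_mul_of_nonneg_right this hzz
      _ = N * Real.exp (ε * δ β) * Real.exp (-zpeSum L κ U) * h U := by ring

/-! ## §2 ★★★ The composition with the weak BO sub-target -/

/-- ★★★ **THE C3 SKELETON, weak currency**: `ValleyBOWeakAt L δ η → ValleyGeomAt L δ η → (∀ M, eventually M·λ_b(L³β) ≤ δ β) → ValleyKernelRowBoundAt L δ η`.  The two
`o(δ)` tolerances are tuned to a quarter of the valley gain `2·gain1Slope·c₀·δ` each (the Lipschitz loss has already eaten half of `4·gain1Slope·c₀·δ`). [cite: Luscher1983, §3] [cite: LuscherMunster1984, §2] -/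
theorem valleyKernelRowBoundAt_of_boWeak_geom {δ η : ℝ → ℝ} (hBO : ValleyBOWeakAt L δ η) (hG : ValleyGeomAt L δ η) (hδ0 : ∀ β, 0 < δ β)
    (hδ : ∀ M : ℝ, ∃ β0 : ℝ, ∀ β : ℝ, β0 ≤ β → M * bareLambda ((L : ℝ) ^ 3 * β) ≤ δ β) :
    ValleyKernelRowBoundAt L δ η := by
  intro A
  obtain ⟨κ, hκ, hbo⟩ := hBO
  obtain ⟨c₀, hc₀, hgeom⟩ := hG
  -- constants
  set n : ℕ := Fintype.card (Edge 3 L) * 3 with hn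
  set gS : ℝ := gain1Slope L κ with hgS
  have hgS0 : 0 < gS := gain1Slope_pos L hκ
  -- the geometry tolerance: Lipschitz loss ≤ half the gain, `n√(κ/2)·εG ≤ 2 gS c₀`
  set εG : ℝ := 2 * gS * c₀ / ((n : ℝ) * Real.sqrt (κ / 2) + 1) with hεG
  have hden : 0 < (n : ℝ) * Real.sqrt (κ / 2) + 1 := by positivity
  have hεG0 : 0 < εG := by rw [hεG]; positivity
  have hεGle : (n : ℝ) * (Real.sqrt (κ / 2) * εG) ≤ 2 * gS * c₀ := by
    rw [hεG]
    have : (n : ℝ) * (Real.sqrt (κ / 2) * (2 * gS * c₀ / ((n : ℝ) * Real.sqrt (κ / 2) + 1))) =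
        ((n : ℝ) * Real.sqrt (κ / 2)) / ((n : ℝ) * Real.sqrt (κ / 2) + 1) * (2 * gS * c₀) := by
      field_simp
    rw [this]
    have hfrac : ((n : ℝ) * Real.sqrt (κ / 2)) / ((n : ℝ) * Real.sqrt (κ / 2) + 1) ≤ 1 := by
      rw [div_le_one hden]; linarith
    have h2 : 0 ≤ 2 * gS * c₀ := by positivity
    exact mul_le_of_le_one_left h2 hfrac
  -- the BO tolerance: a quarter of the gain on each side
  have hεB0 : 0 < gS * c₀ / 2 := by positivity
  obtain ⟨βB, hB⟩ := hbo (gS * c₀ / 2) hεB0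
  obtain ⟨βG, hGe⟩ := hgeom εG hεG0
  obtain ⟨βM, hM⟩ := hδ (A / (gS * c₀))
  refine ⟨max βB (max βG βM), fun β hβ => ?_⟩
  have hβB : βB ≤ β := (le_max_left _ _).trans hβ
  have hβG : βG ≤ β := ((le_max_left _ _).trans (le_max_right _ _)).trans hβ
  have hβM : βM ≤ β := ((le_max_right _ _).trans (le_max_right _ _)).trans hβ
  obtain ⟨N, hN, hfloor, h, c, Ch, hhm, hc, hh0, hhC, hhc, hrow⟩ := hB β hβB
  refine ⟨h, c, Ch, hhm, hc, hh0, hhc, hhC, fun U hU => ?_⟩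
  have hhC' : ∀ V, |h V| ≤ Ch := fun V => by rw [abs_of_nonneg (hh0 V)]; exact hhC V
  refine (integral_indicator_kernel_le_transferApply (measurableSet_valleySet (δ β) (η β)) hhm hh0 hhC' U).trans ?_
  refine (hrow U hU).trans ?_
  -- the zero-point sum at `U`: vacuum + gain − Lipschitz loss
  obtain ⟨g, θ, k, hnear, hfar⟩ := hGe β hβG U hU
  classical
  have hdiag := Frame.isDiag_eigenvectorBasis (covCurl U) (finrank_linkSpace L)
  have hδβ : 0 ≤ δ β := (hδ0 β).le
  have hδpos : 0 ≤ εG * δ β := mul_nonneg hεG0.le hδβ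
  have hzpe := sum_modeZPE_ge_vacuum_add_gain_of_near L g θ hdiag hκ hδpos hnear k
  rw [sum_modeZPE_eq_zpeSum L hdiag κ] at hzpe
  have hloss : ((Fintype.card (Edge 3 L) * 3 : ℕ) : ℝ) * (Real.sqrt (κ / 2) * (εG * δ β)) ≤ 2 * gS * c₀ * δ β := by
    have := mul_le_mul_of_nonneg_right hεGle hδβ
    have e : ((Fintype.card (Edge 3 L) * 3 : ℕ) : ℝ) * (Real.sqrt (κ / 2) * (εG * δ β)) = (n : ℝ) * (Real.sqrt (κ / 2) * εG) * δ β := by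
      rw [hn]; ring
    rw [e]; exact this
  have hgain : 4 * (gS * (c₀ * δ β)) ≤ 4 * (gS * ‖((2 * θ k : ℝ) : AddCircle (2 * Real.pi / L))‖) :=
    mul_le_mul_of_nonneg_left (mul_le_mul_of_nonneg_left hfar hgS0.le) (by norm_num)
  have hz : 6 * toronZPE L κ 0 0 + 2 * gS * c₀ * δ β ≤ zpeSum L κ U := by rw [hgS] at hgain hloss ⊢; linarith
  -- the scale condition: `gS c₀ δ ≥ A λ_b`
  have hscale : A * bareLambda ((L : ℝ) ^ 3 * β) ≤ gS * c₀ * δ β := by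
    have h1 := hM β hβM
    have h2 : 0 < gS * c₀ := by positivity
    rw [div_mul_eq_mul_div, div_le_iff₀ h2] at h1
    linarith
  -- assemble: `N e^{εδ} e^{−zpe} ≤ e^{−Aλ_b} λ₀`
  set lam : ℝ := bareLambda ((L : ℝ) ^ 3 * β) with hlam
  set Z : ℝ := toronZPE L κ 0 0 with hZ
  set εδ : ℝ := gS * c₀ / 2 * δ β with hεδ
  have hl0 : 0 ≤ levelValue su2Rep L β 0 := le_trans (by positivity) hfloor
  have hE1 : Real.exp (A * lam + 2 * εδ - 2 * gS * c₀ * δ β) ≤ 1 := by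
    rw [Real.exp_le_one_iff, hεδ]
    linarith
  have hexp : Real.exp εδ * Real.exp (-(6 * Z + 2 * gS * c₀ * δ β)) =
      Real.exp (-(6 * Z)) * Real.exp (-εδ) * (Real.exp (-(A * lam)) * Real.exp (A * lam + 2 * εδ - 2 * gS * c₀ * δ β)) := by
    simp only [← Real.exp_add]; congr 1; ring
  have key : N * Real.exp εδ * Real.exp (-zpeSum L κ U) ≤ Real.exp (-(A * lam)) * levelValue su2Rep L β 0 := by
    calc N * Real.exp εδ * Real.exp (-zpeSum L κ U)
        ≤ N * Real.exp εδ * Real.exp (-(6 * Z + 2 * gS * c₀ * δ β)) :=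
          mul_le_mul_of_nonneg_left (Real.exp_le_exp.mpr (by linarith)) (by positivity)
      _ = (N * Real.exp (-(6 * Z)) * Real.exp (-εδ)) * (Real.exp (-(A * lam)) * Real.exp (A * lam + 2 * εδ - 2 * gS * c₀ * δ β)) := by
          rw [mul_assoc N, hexp]; ring
      _ ≤ levelValue su2Rep L β 0 * (Real.exp (-(A * lam)) * 1) :=
          mul_le_mul hfloor (mul_le_mul_of_nonneg_left hE1 (Real.exp_pos _).le) (by positivity) hl0
      _ = Real.exp (-(A * lam)) * levelValue su2Rep L β 0 := by ring
  exact mul_le_mul_of_nonneg_right key (hh0 U)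

/-! ## §3 ★★★ End to end at polynomial scales -/

/-- ★★★ **END TO END, weak BO + GEOM**: `0 < p < 1/3 → q < 8/9 → ValleyBOWeakAt L (β^{−p}) (β^{−q}) → ValleyGeomAt L (β^{−p}) (β^{−q}) → InnerNoIntruderOneOrbitAt L (β^{−p}) →`
COARSE-UPPER(L) (verbatim body of `CoarseNoIntruderAt L`). [cite: Luscher1983, §3] [cite: LuscherMunster1984, §2] -/
theorem coarseNoIntruderAt_of_boWeak_geom_pow {p q : ℝ} (hp0 : 0 < p) (hp : p < 1 / 3) (hq : q < 8 / 9)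
    (hBO : ValleyBOWeakAt L (powScale p) (powScale q)) (hG : ValleyGeomAt L (powScale p) (powScale q)) (hI : InnerNoIntruderOneOrbitAt L (powScale p)) :
    ∀ k : ℕ, ∀ d : ℝ, d < levelGap k → ∃ lam0 : ℝ, 0 < lam0 ∧ ∀ lam : ℝ, 0 < lam → lam ≤ lam0 →
      ∀ β : ℝ, InFemtoWindow lam β L →
        levelValue su2Rep L β k ≤ Real.exp (-(d * luscherLambda β L) / L) * levelValue su2Rep L β 0 :=
  coarseNoIntruderAt_of_kernelRow_pow₉ hp0 hp hq
    (valleyKernelRowBoundAt_of_boWeak_geom hBO hG (fun β => powScale_pos p β) (powScale_dominates_bareLambda hp)) hI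

/-- ★★★ **END TO END, weak BO alone** (geometry discharged by `valleyGeomAt_pow`): `0 < p < 1/3 → 4p < q < 8/9 → ValleyBOWeakAt L (β^{−p}) (β^{−q}) →
InnerNoIntruderOneOrbitAt L (β^{−p}) →` COARSE-UPPER(L).  Exponents of record `(1/16, 0.85)` qualify. [cite: Luscher1983, §3] [cite: LuscherMunster1984, §2] -/
theorem coarseNoIntruderAt_of_boWeak_pow {p q : ℝ} (hp0 : 0 < p) (hp : p < 1 / 3) (hpq : 4 * p < q) (hq : q < 8 / 9)
    (hBO : ValleyBOWeakAt L (powScale p) (powScale q)) (hI : InnerNoIntruderOneOrbitAt L (powScale p)) :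
    ∀ k : ℕ, ∀ d : ℝ, d < levelGap k → ∃ lam0 : ℝ, 0 < lam0 ∧ ∀ lam : ℝ, 0 < lam → lam ≤ lam0 →
      ∀ β : ℝ, InFemtoWindow lam β L →
        levelValue su2Rep L β k ≤ Real.exp (-(d * luscherLambda β L) / L) * levelValue su2Rep L β 0 :=
  coarseNoIntruderAt_of_boWeak_geom_pow hp0 hp hq hBO (valleyGeomAt_pow hp0 hpq) hI

end Summit.QuantumFields.YangMills.Theorems.FemtoTransferGap

end
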